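import Literature.NumberTheory.EllipticCurves.IsogenyDualInseparableProofs
import Mathlib.GroupTheory.Perm.Cycle.Type
import HarnessLib

/-!
# Deuring's criterion downstairs: complex multiplication by `√d` with `(d/p) = 1` forces ordinary

Topic `NumberTheory/EllipticCurves` (trunk T-ELLARITH, notion `cm_endomorphisms_isogeny`). A
*proofs* file (theorems only, D-0014 append protocol) over the prelude
`Literature.NumberTheory.EllipticCurves.Isogeny`, serving the discharge of the named fact
`Literature.NumberTheory.EllipticCurves.Deuring1941_exists_pTorsion_reduction_of_split`
(`ComplexMultiplicationDeuringReductionProofs`; Lang, *Elliptic Functions*, Ch. 13 §4 Thm. 12,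
first assertion, split case: the reduction of a CM curve at a prime split in the CM field is not
supersingular). It proves the **characteristic-`p` half of that theorem**, in the form in which
the tree can consume it:

* `WeierstrassCurve.Isogeny.exists_ne_zero_nsmul_eq_zero_of_comp_self_eq_smul` — let `E` be an
  elliptic curve over a field `K` of odd characteristic `p`, and `ψ : E → E` an isogeny over `K`
  with `ψ ∘ ψ = [d]` for an integer `d < 0` with `p ∤ d` and `d` a square modulo `p` (so that
  `ℤ[ψ] ≅ ℤ[√d]` and `p` splits in `ℚ(√d)`). Then `E(K̄)` has a point of order `p`, i.e. `E` is
  ordinary (not supersingular).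

This is the mechanism of Lang's proof of Thm. 12 (PDF pp. 140–141: for `p𝔬_k = 𝔭𝔭'` an
endomorphism lying in `𝔭'` but not in `𝔭` has `p`-power degree and separable reduction, *"hence
`Ā` has a non-trivial point of order `p`"*) and of Deuring's theorem that the endomorphism algebra
of a supersingular curve is the quaternion algebra ramified at `p`, in which no imaginary
quadratic field with `p` split embeds (Deuring 1941; Waterhouse 1969, Thm. 4.1). Applied to the
reduction `ψ̄` of the complex multiplication `[√d]` it gives Thm. 12; that application is the
business of the consumer.

## The proof

Write `N = deg ψ`; `deg` is multiplicative (`Isogeny.deg_comp`) and `deg [m] = m²`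
(`degHom_zsmul`), so `N² = d²`, `N = -d`. The degree is a quadratic form on `End_K(E)`
(Cor. III.6.3, the tree's `degHom_isQuadraticForm_holds`), so
`deg(ψ + [m]) = N + m t + m²` with `t = deg(ψ + 1) - deg ψ - 1`; and
`(ψ + 1) ∘ (ψ - 1) = [d - 1]` gives `(N + 1)² - t² = (d - 1)²`, i.e. `t = 0`
(`degHom_add_zsmul_id_eq`). Choose `s ∈ ℤ` with `p ∣ s² - d` exactly once (`d` is a non-zero
square mod `p`, `p` odd: `exists_sq_sub_dvd_not_sq_dvd`). Then `α± = ψ ± [s]` are isogenies of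
degree `s² - d = p·t'`, `p ∤ t'`. If `E(K̄)` had no point of order `p`, no kernel would have order
divisible by `p` (Cauchy), so `deg = #ker · deg_i` (Thm. III.4.10(a), the tree's
`card_ker_mul_finInsepDegree_eq_deg`) forces `deg_i α± = p`: both `α±` factor through the
`p`-Frobenius `F : E → E^{(p)}` (Cor. II.2.12, the tree's `exists_eq_comp_frobeniusTwistIsogeny`),
`α± = λ± ∘ F`, whence `[2s] = α₊ - α₋ = (λ₊ - λ₋) ∘ F` and `p ∣ deg [2s] = 4s²` — impossible for
`p` odd, `p ∤ s`.

## References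

* [Lang1987] S. Lang, *Elliptic Functions*, 2nd ed., GTM 112, Springer 1987 (held:
  `book:lang1987-elliptic-functions`): Ch. 13 §4, Thm. 12 and its proof (PDF pp. 140–141); Ch. 13
  §2, Thms. 4–5 (PDF pp. 133–134).
* [Deuring1941] M. Deuring, *Die Typen der Multiplikatorenringe elliptischer Funktionenkörper*,
  Abh. Math. Sem. Univ. Hamburg 14 (1941), 197–272.
* [Waterhouse1969] W. C. Waterhouse, *Abelian varieties over finite fields*, Ann. Sci. ÉNS (4) 2
  (1969), 521–560, Thm. 4.1.
* [SilvermanAEC2009] J. H. Silverman, *The Arithmetic of Elliptic Curves*, 2nd ed., GTM 106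
  (2009): Cor. II.2.12, Thm. III.4.10(a), Cor. III.6.3, Thm. III.6.2(d), Thm. V.3.1.

## Design

`noncomputable section`, `open scoped Classical`, one universe `u`, deliberate dot-notation
extensions in `namespace WeierstrassCurve` / `WeierstrassCurve.Isogeny` (the namespaces of the
prelude `Isogeny`), as in the sibling proofs files; nothing is defined. The endomorphisms
`ψ ± [s]` are handled as elements `ψ.toAddMonoidHom + s • id` of `Hom_K(E, E) = homModule W W`
with the degree function `degHom` of `IsogenyDegree`, for which the tree has the quadratic-form
calculus (`IsogenyDeterminantProofs`, `IsogenyDegreeQuadraticFormProofs`).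
-/

noncomputable section

open scoped Classical

universe u

namespace WeierstrassCurve

open Literature.NumberTheory.EllipticCurves

variable {K : Type u} [Field K] {W W' : WeierstrassCurve K}

/-! ## Arithmetic preliminaries -/

/-- For an odd prime `p` and an integer `d` prime to `p` which is a square modulo `p`, there is an
integer `s` with `p ∣ s² - d` but `p² ∤ s² - d` (if `p² ∣ s₀² - d`, replace `s₀` by `s₀ + p`:
`(s₀ + p)² - d ≡ 2 p s₀ (mod p²)` and `p ∤ 2 s₀`). [folklore] -/
theorem exists_sq_sub_dvd_not_sq_dvd {p : ℕ} (hp : p.Prime) (hp2 : p ≠ 2) {d : ℤ}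
    (hpd : ¬ (p : ℤ) ∣ d) (hsq : IsSquare ((d : ℤ) : ZMod p)) :
    ∃ s : ℤ, (p : ℤ) ∣ s ^ 2 - d ∧ ¬ (p : ℤ) ^ 2 ∣ s ^ 2 - d := by
  haveI : Fact p.Prime := ⟨hp⟩
  obtain ⟨a, ha⟩ := hsq
  set s₀ : ℤ := (a.val : ℤ) with hs₀
  have hs₀a : ((s₀ : ℤ) : ZMod p) = a := by
    rw [hs₀, Int.cast_natCast, ZMod.natCast_zmod_val]
  have h₀ : (p : ℤ) ∣ s₀ ^ 2 - d := by
    rw [← ZMod.intCast_zmod_eq_zero_iff_dvd]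
    push_cast
    rw [hs₀a, ha]
    ring
  have hps₀ : ¬ (p : ℤ) ∣ s₀ := fun h ↦ hpd <| by
    have h2 : (p : ℤ) ∣ s₀ ^ 2 := Dvd.dvd.pow h two_ne_zero
    have := dvd_sub h2 h₀
    rwa [sub_sub_cancel] at this
  have hpi : Prime (p : ℤ) := Nat.prime_iff_prime_int.mp hp
  by_cases h1 : (p : ℤ) ^ 2 ∣ s₀ ^ 2 - d
  · refine ⟨s₀ + p, ?_, fun h2 ↦ ?_⟩
    · have : (s₀ + p) ^ 2 - d = (s₀ ^ 2 - d) + p * (2 * s₀ + p) := by ring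
      rw [this]
      exact dvd_add h₀ (dvd_mul_right _ _)
    · have h3 : (p : ℤ) ^ 2 ∣ (p : ℤ) * (2 * s₀ + p) := by
        have : (p : ℤ) * (2 * s₀ + p) = ((s₀ + p) ^ 2 - d) - (s₀ ^ 2 - d) := by ring
        rw [this]
        exact dvd_sub h2 h1
      rw [pow_two] at h3
      have h4 : (p : ℤ) ∣ 2 * s₀ + p := Int.dvd_of_mul_dvd_mul_left (by exact_mod_cast hp.ne_zero) h3
      have h5 : (p : ℤ) ∣ 2 * s₀ := by
        have := dvd_sub h4 (dvd_refl (p : ℤ))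
        rwa [add_sub_cancel_right] at this
      rcases hpi.dvd_or_dvd h5 with h6 | h6
      · have : p ∣ 2 := by exact_mod_cast h6
        exact hp2 ((Nat.prime_dvd_prime_iff_eq hp Nat.prime_two).mp this)
      · exact hps₀ h6
  · exact ⟨s₀, h₀, h1⟩

/-! ## `deg(ψ + [m]) = m² - d` for `ψ ∘ ψ = [d]` (Cor. III.6.3) -/

section Degree

variable [W.IsElliptic]

omit [W.IsElliptic] in
/-- `m • [1]` acts as `P ↦ m • P`. [folklore] -/
theorem zsmul_id_apply (m : ℤ) (P : W.geomPoints) :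
    (m • AddMonoidHom.id W.geomPoints) P = m • P :=
  rfl

/-- **`deg(ψ + [m]) = m² - d` for an isogeny `ψ` with `ψ ∘ ψ = [d]`, `d < 0`** (in `Hom_K(E, E)`,
for the degree `degHom` with `deg 0 = 0`). By Cor. III.6.3 (the tree's
`degHom_isQuadraticForm_holds`), `deg(ψ + [m]) = N + m t + m²` with `N = deg ψ` and
`t = deg(ψ + 1) - deg ψ - 1`; multiplicativity of the degree applied to `ψ ∘ ψ = [d]` and to
`(ψ + 1) ∘ (ψ - 1) = [d - 1]` gives `N² = d²` (so `N = -d`) and `(N + 1)² - t² = (d - 1)²`, so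
`t = 0`. Silverman, *AEC*, Cor. III.6.3 with Thm. III.6.2(d).
[cite: SilvermanAEC2009, Cor. III.6.3] -/
theorem Isogeny.degHom_add_zsmul_id_eq (ψ : Isogeny W W) {d : ℤ} (hψ : ∀ P, ψ (ψ P) = d • P)
    (hd : d < 0) (m : ℤ) :
    degHom W W (ψ.toAddMonoidHom + m • AddMonoidHom.id W.geomPoints) = m ^ 2 - d := by
  have h63 := degHom_isQuadraticForm_holds W W
  set f := ψ.toAddMonoidHom with hf_def
  set g := AddMonoidHom.id W.geomPoints with hg_def
  have hgP : ∀ (n : ℤ) (P : W.geomPoints), (n • g) P = n • P := fun _ _ ↦ rfl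
  have hfP : ∀ P, f P = ψ P := fun _ ↦ rfl
  have hffP : ∀ P, f (f P) = d • P := fun P ↦ by rw [hfP, hfP, hψ]
  have hf : f ∈ homModule W W := ψ.toAddMonoidHom_mem_homModule
  have hg : g ∈ homModule W W := id_mem_homModule W
  have hg1 : degHom W W g = 1 := degHom_id W
  -- `ψ ∘ ψ = [d]`, so `N² = d²` and `N = -d` for `N = deg ψ`
  have hff : f.comp f = d • g := AddMonoidHom.ext fun P ↦ by
    rw [hgP, AddMonoidHom.comp_apply, hffP]
  have hN0 : 0 ≤ degHom W W f := by
    rw [hf_def, degHom_toAddMonoidHom]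
    exact Int.natCast_nonneg _
  have hNN : degHom W W f * degHom W W f = d ^ 2 := by
    rw [← degHom_comp hf hf, hff, degHom_zsmul h63 hg, hg1, mul_one]
  have hN : degHom W W f = -d := by
    have h0 : (degHom W W f + d) * (degHom W W f - d) = 0 := by linear_combination hNN
    rcases mul_eq_zero.mp h0 with h | h
    · linarith
    · exfalso; linarith
  -- the polar pairing `t = B(ψ, 1)` vanishes: `(ψ + 1)(ψ - 1) = [d - 1]`
  have hadd : ∀ n : ℤ, degHom W W (f + n • g) =
      degHom W W f + n * (degHom W W (f + g) - degHom W W f - degHom W W g) + n ^ 2 := fun n ↦ by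
    rw [degHom_add_zsmul h63 hf hg n, hg1, mul_one]
  have hcomp : (f + (1 : ℤ) • g).comp (f + (-1 : ℤ) • g) = (d - 1) • g :=
    AddMonoidHom.ext fun P ↦ by
      simp only [AddMonoidHom.comp_apply, AddMonoidHom.add_apply, hgP, map_add, map_zsmul, hffP]
      module
  have hmul : degHom W W (f + (1 : ℤ) • g) * degHom W W (f + (-1 : ℤ) • g) = (d - 1) ^ 2 := by
    rw [← degHom_comp (add_mem hf (Submodule.smul_mem _ _ hg))
      (add_mem hf (Submodule.smul_mem _ _ hg)), hcomp, degHom_zsmul h63 hg, hg1, mul_one]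
  rw [hadd, hadd, hN, hg1] at hmul
  have ht : degHom W W (f + g) - -d - 1 = 0 := by
    have : (degHom W W (f + g) - -d - 1) ^ 2 = 0 := by linear_combination -hmul
    exact pow_eq_zero_iff two_ne_zero |>.mp this
  rw [hadd m, hg1, hN, ht]
  ring

/-- `ψ + [m] ≠ 0` for `ψ ∘ ψ = [d]`, `d < 0` (its degree `m² - d` is positive, `deg 0 = 0`).
[folklore] -/
theorem Isogeny.toAddMonoidHom_add_zsmul_id_ne_zero (ψ : Isogeny W W) {d : ℤ}
    (hψ : ∀ P, ψ (ψ P) = d • P) (hd : d < 0) (m : ℤ) :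
    ψ.toAddMonoidHom + m • AddMonoidHom.id W.geomPoints ≠ 0 := fun h ↦ by
  have h1 := ψ.degHom_add_zsmul_id_eq hψ hd m
  rw [h, degHom_zero] at h1
  nlinarith [sq_nonneg m]

/-- **`ψ + [m]` is an isogeny of degree `m² - d`** for `ψ ∘ ψ = [d]`, `d < 0` (`Hom_K(E, E)` is a
group, the tree's `mem_homModule_iff_holds`; the degree by `degHom_add_zsmul_id_eq`).
[cite: SilvermanAEC2009, Cor. III.6.3] -/
theorem Isogeny.exists_toAddMonoidHom_eq_add_zsmul_id (ψ : Isogeny W W) {d : ℤ}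
    (hψ : ∀ P, ψ (ψ P) = d • P) (hd : d < 0) (m : ℤ) :
    ∃ α : Isogeny W W, α.toAddMonoidHom = ψ.toAddMonoidHom + m • AddMonoidHom.id W.geomPoints ∧
      (α.deg : ℤ) = m ^ 2 - d := by
  have hmem : ψ.toAddMonoidHom + m • AddMonoidHom.id W.geomPoints ∈ homModule W W :=
    add_mem ψ.toAddMonoidHom_mem_homModule (Submodule.smul_mem _ _ (id_mem_homModule W))
  rcases (mem_homModule_iff_holds W W _).mp hmem with h | ⟨α, hα⟩
  · exact (ψ.toAddMonoidHom_add_zsmul_id_ne_zero hψ hd m h).elim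
  · refine ⟨α, hα, ?_⟩
    rw [← degHom_toAddMonoidHom, hα, ψ.degHom_add_zsmul_id_eq hψ hd m]

end Degree

/-! ## Kernels and the Frobenius when `E(K̄)` has no point of order `p` -/

section NoPTorsion

variable [W.IsElliptic] [W'.IsElliptic] (p : ℕ) [Fact p.Prime]

omit [W.IsElliptic] [W'.IsElliptic] in
/-- If `E(K̄)` has no point of order `p`, no isogeny out of `E` has kernel of order divisible by
`p` (Cauchy's theorem in the finite group `ker φ`). [folklore] -/
theorem Isogeny.not_dvd_card_ker_of_forall_nsmul_ne_zero
    (hnone : ∀ P : W.geomPoints, P ≠ 0 → p • P ≠ 0) (φ : Isogeny W W') :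
    ¬ p ∣ Nat.card φ.toAddMonoidHom.ker := fun h ↦ by
  obtain ⟨x, hx⟩ := exists_prime_addOrderOf_dvd_card' (G := φ.toAddMonoidHom.ker) p h
  have hx0 : (x : W.geomPoints) ≠ 0 := fun h0 ↦ by
    have : x = 0 := Subtype.ext h0
    rw [this, addOrderOf_zero] at hx
    exact (Fact.out : p.Prime).one_lt.ne hx
  refine hnone x hx0 ?_
  have h1 : p • x = 0 := hx ▸ addOrderOf_nsmul_eq_zero x
  have h2 := congrArg Subtype.val h1
  simpa using h2

variable [ExpChar K p]

/-- **An isogeny whose degree is divisible by `p` exactly once and whose kernel has order prime to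
`p` factors through the `p`-Frobenius** `F : E → E^{(p)}`: `deg φ = #ker φ · deg_i φ`
(Thm. III.4.10(a)) forces `deg_i φ = p`, and Cor. II.2.12 factors `φ = λ ∘ F`.
[cite: SilvermanAEC2009, Cor. II.2.12 with Thm. III.4.10(a)] -/
theorem Isogeny.exists_eq_comp_frobeniusTwistIsogeny_one (φ : Isogeny W W') {t : ℕ}
    (hdeg : φ.deg = p * t) (ht : ¬ p ∣ t) (hker : ¬ p ∣ Nat.card φ.toAddMonoidHom.ker) :
    ∃ lam : Isogeny (W.frobeniusTwist p 1) W', φ = lam.comp (W.frobeniusTwistIsogeny p 1) := by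
  have hp : p.Prime := Fact.out
  obtain ⟨r, lam, hr, hcomp, -, -⟩ := φ.exists_eq_comp_frobeniusTwistIsogeny p
  have h := φ.card_ker_mul_finInsepDegree_eq_deg
  rw [hr, hdeg] at h
  have hr1 : r = 1 := by
    rcases Nat.lt_trichotomy r 1 with h1 | h1 | h1
    · exfalso
      have : r = 0 := by omega
      rw [this, pow_zero, mul_one] at h
      exact hker (h ▸ dvd_mul_right p t)
    · exact h1
    · exfalso
      have h2 : p ^ 2 ∣ Nat.card φ.toAddMonoidHom.ker * p ^ r :=
        (pow_dvd_pow p (by omega)).trans (dvd_mul_left _ _)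
      rw [h, pow_two] at h2
      exact ht (Nat.dvd_of_mul_dvd_mul_left hp.pos h2)
  subst hr1
  exact ⟨lam, hcomp⟩

end NoPTorsion

/-! ## Deuring's criterion: `ψ ∘ ψ = [d]` with `(d/p) = 1` forces a point of order `p` -/

section Deuring

variable [W.IsElliptic]

/-- **Complex multiplication by `√d` with `d` a non-zero square modulo `p` forces ordinary
reduction type** (the characteristic-`p` mechanism of Lang, *Elliptic Functions*, Ch. 13 §4,
proof of Thm. 12, PDF pp. 140–141; Deuring 1941). Let `E` be an elliptic curve over a field `K` of
odd characteristic `p` and `ψ : E → E` an isogeny over `K` with `ψ (ψ P) = d • P` on `E(K̄)` for an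
integer `d < 0` such that `p ∤ d` and `d` is a square modulo `p`. Then `E(K̄)` has a point `P ≠ O`
with `p • P = O` (so `E` is not supersingular). Proof: with `s² - d = p t'`, `p ∤ t'`
(`exists_sq_sub_dvd_not_sq_dvd`), the isogenies `ψ ± [s]` have degree `p t'`
(`degHom_add_zsmul_id_eq`); were there no point of order `p`, both would have kernel of order
prime to `p`, hence inseparable degree exactly `p`, hence factor through the `p`-Frobenius `F`
(`exists_eq_comp_frobeniusTwistIsogeny_one`); then so would their difference `[2s]`, giving
`p ∣ deg [2s] = 4 s²`, absurd. [cite: Lang1987, Ch. 13 §4 Thm. 12 (proof, PDF pp. 140–141)]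
[cite: Deuring1941] -/
theorem Isogeny.exists_ne_zero_nsmul_eq_zero_of_comp_self_eq_smul (p : ℕ) [Fact p.Prime]
    [CharP K p] (hp2 : p ≠ 2) (ψ : Isogeny W W) {d : ℤ} (hψ : ∀ P, ψ (ψ P) = d • P) (hd : d < 0)
    (hpd : ¬ (p : ℤ) ∣ d) (hsq : IsSquare ((d : ℤ) : ZMod p)) :
    ∃ P : W.geomPoints, P ≠ 0 ∧ p • P = 0 := by
  have hp : p.Prime := Fact.out
  haveI : ExpChar K p := ExpChar.prime hp
  have hpi : Prime (p : ℤ) := Nat.prime_iff_prime_int.mp hp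
  by_contra hcon
  have hnone : ∀ P : W.geomPoints, P ≠ 0 → p • P ≠ 0 := fun P hP h ↦ hcon ⟨P, hP, h⟩
  -- `s` with `s² - d = p t'`, `p ∤ t'`, and `p ∤ s`
  obtain ⟨s, hs1, hs2⟩ := exists_sq_sub_dvd_not_sq_dvd hp hp2 hpd hsq
  have hps : ¬ (p : ℤ) ∣ s := fun h ↦ hpd <| by
    have h2 : (p : ℤ) ∣ s ^ 2 := Dvd.dvd.pow h two_ne_zero
    have := dvd_sub h2 hs1
    rwa [sub_sub_cancel] at this
  obtain ⟨t', ht'⟩ := hs1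
  have hpt' : ¬ (p : ℤ) ∣ t' := fun h ↦ hs2 (by rw [ht', pow_two]; exact mul_dvd_mul_left _ h)
  have ht'0 : 0 < t' := by
    have h1 : 0 < s ^ 2 - d := by nlinarith [sq_nonneg s]
    rw [ht'] at h1
    exact pos_of_mul_pos_right h1 (by exact_mod_cast hp.pos.le)
  lift t' to ℕ using ht'0.le
  have hpt'' : ¬ p ∣ t' := fun h ↦ hpt' (by exact_mod_cast h)
  -- the isogenies `α = ψ + [s]`, `α' = ψ - [s]`, both of degree `p t'`
  obtain ⟨α, hα, hαdeg⟩ := ψ.exists_toAddMonoidHom_eq_add_zsmul_id hψ hd s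
  obtain ⟨α', hα', hα'deg⟩ := ψ.exists_toAddMonoidHom_eq_add_zsmul_id hψ hd (-s)
  rw [even_two.neg_pow] at hα'deg
  have hαd : α.deg = p * t' := by
    have : (α.deg : ℤ) = ((p * t' : ℕ) : ℤ) := by rw [hαdeg, ht']; push_cast; ring
    exact_mod_cast this
  have hα'd : α'.deg = p * t' := by
    have : (α'.deg : ℤ) = ((p * t' : ℕ) : ℤ) := by rw [hα'deg, ht']; push_cast; ring
    exact_mod_cast this
  -- no point of order `p`: both factor through the `p`-Frobenius
  obtain ⟨lam, hlam⟩ := α.exists_eq_comp_frobeniusTwistIsogeny_one p hαd hpt''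
    (α.not_dvd_card_ker_of_forall_nsmul_ne_zero p hnone)
  obtain ⟨lam', hlam'⟩ := α'.exists_eq_comp_frobeniusTwistIsogeny_one p hα'd hpt''
    (α'.not_dvd_card_ker_of_forall_nsmul_ne_zero p hnone)
  -- `[2s] = (λ - λ') ∘ F`
  set F := W.frobeniusTwistIsogeny p 1 with hF
  have hdiff : (lam.toAddMonoidHom - lam'.toAddMonoidHom).comp F.toAddMonoidHom =
      (2 * s) • AddMonoidHom.id W.geomPoints := AddMonoidHom.ext fun P ↦ by
    have h1 : α P = lam (F P) := by rw [hlam, Isogeny.comp_apply]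
    have h2 : α' P = lam' (F P) := by rw [hlam', Isogeny.comp_apply]
    have h3 : α P = ψ P + s • P := by
      rw [← Isogeny.coe_toAddMonoidHom, hα, AddMonoidHom.add_apply, zsmul_id_apply,
        Isogeny.coe_toAddMonoidHom]
    have h4 : α' P = ψ P + (-s) • P := by
      rw [← Isogeny.coe_toAddMonoidHom, hα', AddMonoidHom.add_apply, zsmul_id_apply,
        Isogeny.coe_toAddMonoidHom]
    rw [AddMonoidHom.comp_apply, AddMonoidHom.sub_apply, zsmul_id_apply,
      Isogeny.coe_toAddMonoidHom, Isogeny.coe_toAddMonoidHom, Isogeny.coe_toAddMonoidHom,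
      ← h1, ← h2, h3, h4, neg_smul, mul_smul, two_smul]
    abel
  have hmem : lam.toAddMonoidHom - lam'.toAddMonoidHom ∈ homModule (W.frobeniusTwist p 1) W :=
    sub_mem lam.toAddMonoidHom_mem_homModule lam'.toAddMonoidHom_mem_homModule
  have h63 := degHom_isQuadraticForm_holds W W
  have hdeg2s : degHom W W ((2 * s) • AddMonoidHom.id W.geomPoints) = (2 * s) ^ 2 := by
    rw [degHom_zsmul h63 (id_mem_homModule W), degHom_id, mul_one]
  rcases (mem_homModule_iff_holds (W.frobeniusTwist p 1) W _).mp hmem with h0 | ⟨μ, hμ⟩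
  · -- `λ = λ'` would give `[2s] = 0`
    rw [h0, AddMonoidHom.zero_comp] at hdiff
    have h1 := hdeg2s
    rw [← hdiff, degHom_zero] at h1
    have : (2 * s) ^ 2 ≠ 0 := pow_ne_zero 2 (mul_ne_zero two_ne_zero (fun h ↦ hps (h ▸ dvd_zero _)))
    exact this h1.symm
  · -- `deg [2s] = deg μ · p`
    have hcomp : (μ.comp F).toAddMonoidHom = (2 * s) • AddMonoidHom.id W.geomPoints := by
      rw [← hdiff, ← hμ]; rfl
    have h1 : ((μ.comp F).deg : ℤ) = (2 * s) ^ 2 := by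
      rw [← degHom_toAddMonoidHom, hcomp, hdeg2s]
    rw [Isogeny.deg_comp, hF, deg_frobeniusTwistIsogeny, pow_one, Nat.cast_mul] at h1
    have h2 : (p : ℤ) ∣ (2 * s) ^ 2 := ⟨μ.deg, by rw [← h1]; ring⟩
    rcases hpi.dvd_or_dvd (hpi.dvd_of_dvd_pow h2) with h3 | h3
    · have : p ∣ 2 := by exact_mod_cast h3
      exact hp2 ((Nat.prime_dvd_prime_iff_eq hp Nat.prime_two).mp this)
    · exact hps h3

end Deuring

end WeierstrassCurve
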